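import Summits.KontsevichZagierPeriods.Zeta5Search.WedgeDictionaryRec3
import Summits.KontsevichZagierPeriods.Zeta5Search.SymRayBasics
import HarnessLib

/-!
# The constant-term functional `V` along slot 7: the four-term relation (cell `pub-zeta5`, gen-1 g5, D2 step 1)

HONEST FRAMING: systematic search; no irrationality claim unless certified.

OUR work (Summit side; planner gen-1 g5, 2026-08-20; memo `pub-zeta5-gen-1/D2-FEASIBILITY-g5.md` §2, §5 item 1).
The wedge dictionary's P-parts are the mixed Casoratians `P̂/ρ = U V′ − U′ V`, `P/ρ = W′ V − W V′` of the three
canonical coefficient functionals `U = coeffU`, `W = coeffW`, `V = coeffV` of the dual very-well-poised series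
`F̃₇(b) = U ζ(5) + W ζ(3) − V` (`WedgeDictionary`).  The CF-M3 machine (`WedgeDictionaryRec3`: `fourTerm_coeff_rel`,
`quadM3_rec3`; `WedgeDictionaryOmegaRec*`, `WedgeDictionaryGaugeStep`) propagates 2×2 Casoratians of solutions of the
four-term slot relation.  This file supplies the missing input for the P-side: **`V` satisfies the same homogeneous
four-term relation along slot 7 as `U` and `W`** (`fourTerm_coeffV_rel`), with the same coefficients `topGamma0..3`.

Mechanism (the `V`-version of the linear-functional summability principle, `coeffV_rel_of_summable4`): for a summable
combination `Σ cᵢ·numPoly(bᵢ) = g(X+1)X⁶ − g(X+N)⁶` the partial-fraction data of the combination are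
`shiftUp γ − padData γ` (`γ` = data of `g(t+1)/((t+1)_N)⁶`), so the `ζ(5)`/`ζ(3)` coefficient sums telescope to `0`
(`coeff_rel_of_summable`), while the harmonic-number-weighted sum defining `V` telescopes, by Abel summation
`H_{p+1}^{(i)} − H_p^{(i)} = (p+1)^{−i}`, to the BOUNDARY TERM `pfEval (N−1) 6 γ 0 = g(1)/((1)_N)⁶`.  For the slot-7
certificate `topTelescoper b = (X + b₀)(X − 1)·hPoly b` (`WedgeDictionaryTopRelation`) this boundary term vanishes
because of the factor `X − 1`.  (Exact numerical control, memo §2: in a normalisation whose certificate lacks the factor,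
`V` obeys the relation with exactly this non-zero right-hand side.)

Consequences drawn in the memo (not formalised here): the mixed Casoratians `U V′ − U′V`, `W′V − WV′` satisfy REC3
(`quadM3_rec3`'s recurrence) and their CF-M3-gauge images satisfy REC3′ (`OmegaRec.omegaVWP_rec3`); the rank-three
Casoratian `det(U,W,V)` obeys Abel's first-order recurrence (closed form CF-W3, conjectural).
-/

open Finset Polynomial

namespace Summit.KontsevichZagierPeriods.Zeta5Search.WedgeDictionary

open Summit.KontsevichZagierPeriods.Zeta5Search.DualSeries
open Literature.NumberTheory.Transcendental
open Literature.NumberTheory.Transcendental.BallRivoal (pfEval pf_unique poch_pos harm)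

/-! ### Small tools -/

/-- Four-coefficient linearity of `pfEval` (with one added and one subtracted data array). -/
theorem pfEval_comb4V (N K : ℕ) (a0 a1 a2 a3 : ℚ) (c0 c1 c2 c3 d e : ℕ → ℕ → ℚ) (t : ℚ) :
    pfEval N K (fun o p => a0 * c0 o p + a1 * c1 o p + a2 * c2 o p + a3 * c3 o p + d o p - e o p) t =
      a0 * pfEval N K c0 t + a1 * pfEval N K c1 t + a2 * pfEval N K c2 t + a3 * pfEval N K c3 t +
        pfEval N K d t - pfEval N K e t := by
  unfold pfEval
  simp only [add_div, sub_div, mul_div_assoc, sum_add_distrib, sum_sub_distrib, mul_sum]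

/-- Weighted sum of shifted data (`shiftUp γ` are the data of `G(t+1)`). -/
theorem sum_shiftUp_mul (M : ℕ) (γ : ℕ → ℕ → ℚ) (o : ℕ) (f : ℕ → ℚ) :
    ∑ p ∈ range (M + 2), shiftUp γ o p * f p = ∑ p ∈ range (M + 1), γ o p * f (p + 1) := by
  rw [sum_range_succ']
  simp [shiftUp]

/-- Weighted sum of padded data. -/
theorem sum_padData_mul (M : ℕ) (γ : ℕ → ℕ → ℚ) (o : ℕ) (f : ℕ → ℚ) :
    ∑ p ∈ range (M + 2), padData M γ o p * f p = ∑ p ∈ range (M + 1), γ o p * f p := by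
  rw [sum_range_succ]
  have hlast : padData M γ o (M + 1) = 0 := by simp [padData]
  rw [hlast, zero_mul, add_zero]
  exact sum_congr rfl fun p hp => by
    have hp' : p ≤ M := Nat.lt_succ_iff.1 (mem_range.1 hp)
    simp [padData, hp']

/-! ### The `V`-version of the summability principle: the boundary term -/

/-- **Constant terms of a summable combination: the boundary term.** If `b₀, b₁, b₂, b₃` lie in the box at a
common level `N ≥ 1` with `Σ_j b_j ≤ 3N + 1`, and `c₀·numPoly b₀ + ⋯ + c₃·numPoly b₃ = g(X+1)X⁶ − g(X+N)⁶` with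
`deg g < 6N`, then `c₀V(b₀) + c₁V(b₁) + c₂V(b₂) + c₃V(b₃) = g(1)/((1)_N)⁶`.  (For `U`, `W` the right-hand side is
`0`: `coeff_rel_of_summable`.) -/
theorem coeffV_rel_of_summable4 (b₀ b₁ b₂ b₃ : ℕ → ℤ) (N : ℕ) (hN : 1 ≤ N)
    (h₀ : InBox b₀) (h₁ : InBox b₁) (h₂ : InBox b₂) (h₃ : InBox b₃)
    (hs₀ : ∑ j ∈ range 7, b₀ (j + 1) ≤ 3 * b₀ 0 + 1) (hs₁ : ∑ j ∈ range 7, b₁ (j + 1) ≤ 3 * b₁ 0 + 1)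
    (hs₂ : ∑ j ∈ range 7, b₂ (j + 1) ≤ 3 * b₂ 0 + 1) (hs₃ : ∑ j ∈ range 7, b₃ (j + 1) ≤ 3 * b₃ 0 + 1)
    (hN₀ : (b₀ 0).toNat = N) (hN₁ : (b₁ 0).toNat = N) (hN₂ : (b₂ 0).toNat = N) (hN₃ : (b₃ 0).toNat = N)
    (c₀ c₁ c₂ c₃ : ℚ) (g : ℚ[X]) (hg : g.natDegree + 1 ≤ 6 * N)
    (hrel : C c₀ * numPoly b₀ + C c₁ * numPoly b₁ + C c₂ * numPoly b₂ + C c₃ * numPoly b₃ =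
      g.comp (X + C 1) * X ^ 6 - g * (X + C (N : ℚ)) ^ 6) :
    c₀ * coeffV b₀ + c₁ * coeffV b₁ + c₂ * coeffV b₂ + c₃ * coeffV b₃ =
      g.eval 1 / BallRivoal.poch 1 N ^ 6 := by
  obtain ⟨d₀, hd₀⟩ := exists_isPFData b₀ h₀ hs₀
  obtain ⟨d₁, hd₁⟩ := exists_isPFData b₁ h₁ hs₁
  obtain ⟨d₂, hd₂⟩ := exists_isPFData b₂ h₂ hs₂
  obtain ⟨d₃, hd₃⟩ := exists_isPFData b₃ h₃ hs₃
  obtain ⟨γ, hγ⟩ := exists_pf_summable hN hg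
  set e : ℕ → ℕ → ℚ := fun o p =>
    c₀ * d₀ o p + c₁ * d₁ o p + c₂ * d₂ o p + c₃ * d₃ o p + padData (N - 1) γ o p - shiftUp γ o p with he
  -- (1) the corrected data `e` evaluate to zero at every natural point
  have he0 : ∀ t : ℕ, pfEval N 6 e t = 0 := by
    intro t
    have ht : ∀ p, p ≤ N → (t : ℚ) + p + 1 ≠ 0 := fun p _ => by positivity
    have E0 := hd₀ t (by rw [hN₀]; exact ht)
    have E1 := hd₁ t (by rw [hN₁]; exact ht)
    have E2 := hd₂ t (by rw [hN₂]; exact ht)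
    have E3 := hd₃ t (by rw [hN₃]; exact ht)
    rw [hN₀] at E0
    rw [hN₁] at E1
    rw [hN₂] at E2
    rw [hN₃] at E3
    have Esh : pfEval N 6 (shiftUp γ) t = pfEval (N - 1) 6 γ ((t : ℚ) + 1) := by
      rw [show N = (N - 1) + 1 from by omega, pfEval_shiftUp, show N - 1 + 1 - 1 = N - 1 by omega]
    have Epad : pfEval N 6 (padData (N - 1) γ) t = pfEval (N - 1) 6 γ t := pfEval_padData (by omega) _ _ _
    have Etel := telescope_eval hN hrel hγ t
    rw [he, pfEval_comb4V, E0, E1, E2, E3, Esh, Epad]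
    simp only [eval_comp, eval_add, eval_mul, eval_C, eval_X] at Etel ⊢
    linear_combination Etel
  -- (2) hence `e` vanishes identically on its support (uniqueness of partial fractions)
  have hpt : ∀ o p, o < 6 → p ≤ N → e o p = 0 := pf_unique N 6 e 0 (fun t _ => he0 t)
  -- (3) the harmonic-weighted sums: the data of the combination are `shiftUp γ − padData γ`
  have hV : c₀ * coeffV b₀ + c₁ * coeffV b₁ + c₂ * coeffV b₂ + c₃ * coeffV b₃ =
      ∑ o ∈ range 6, ∑ p ∈ range (N + 1), (shiftUp γ o p - padData (N - 1) γ o p) * harm (o + 1) p := by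
    rw [coeffV_eq hd₀, coeffV_eq hd₁, coeffV_eq hd₂, coeffV_eq hd₃, hN₀, hN₁, hN₂, hN₃]
    simp only [mul_sum, ← sum_add_distrib]
    refine sum_congr rfl fun o ho => sum_congr rfl fun p hp => ?_
    have h0 := hpt o p (mem_range.1 ho) (Nat.lt_succ_iff.1 (mem_range.1 hp))
    simp only [he] at h0
    linear_combination (harm (o + 1) p) * h0
  -- (4) Abel summation: `Σ_p (γ_{p-1} − γ_p)·H_p = Σ_p γ_p·(H_{p+1} − H_p) = Σ_p γ_p/(p+1)^{o+1}`
  have hM : N + 1 = (N - 1) + 2 := by omega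
  have hrow : ∀ o, ∑ p ∈ range (N + 1), (shiftUp γ o p - padData (N - 1) γ o p) * harm (o + 1) p =
      ∑ p ∈ range (N - 1 + 1), γ o p * (1 / ((p : ℚ) + 1) ^ (o + 1)) := by
    intro o
    simp only [sub_mul, sum_sub_distrib]
    rw [hM, sum_shiftUp_mul, sum_padData_mul, ← sum_sub_distrib]
    refine sum_congr rfl fun p _ => ?_
    rw [SymRay.harm_succ]  -- (tree lemma, `SymRayBasics`; gen-1's local copy removed: dedup.landed)
    ring
  -- (5) … which is the boundary value `pfEval (N-1) 6 γ 0 = g(1)/((1)_N)⁶`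
  have hpf : pfEval (N - 1) 6 γ 0 = ∑ o ∈ range 6, ∑ p ∈ range (N - 1 + 1), γ o p * (1 / ((p : ℚ) + 1) ^ (o + 1)) := by
    unfold pfEval
    rw [sum_comm]
    refine sum_congr rfl fun o _ => sum_congr rfl fun p _ => ?_
    ring
  have hγ0 := hγ 0 (fun p _ => by positivity)
  simp only [eval_comp, eval_add, eval_X, eval_C, zero_add] at hγ0
  rw [hV, sum_congr rfl fun o _ => hrow o, ← hpf, hγ0]

/-! ### The four-term relation for `V` along slot 7 -/

/-- **The four-term coefficient relation for the constant term.** For `b` in the box with `d(b) ≥ 2` and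
`b₇ + 2 ≤ N`: `γ₃·V(b+3e₇) + γ₂·V(b+2e₇) + γ₁·V(b+e₇) + γ₀·V(b) = 0` (`γ_k = topGamma_k b`), i.e. `V = coeffV`
satisfies the SAME relation as `U`, `W` (`fourTerm_coeff_rel`): the certificate `topTelescoper b` has the factor
`X − 1`, so the boundary term of `coeffV_rel_of_summable4` vanishes. -/
theorem fourTerm_coeffV_rel (b : ℕ → ℤ) (hb : InBox b) (hd : 2 ≤ dOf b) (h7 : b 7 + 2 ≤ b 0) :
    topGamma3 b * coeffV (bump (bump (bump b 6) 6) 6) + topGamma2 b * coeffV (bump (bump b 6) 6) +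
        topGamma1 b * coeffV (bump b 6) + topGamma0 b * coeffV b = 0 := by
  have hi7 : (6 : ℕ) ∈ range 7 := mem_range.2 (by norm_num)
  set b1 := bump b 6 with hb1def
  set b2 := bump b1 6 with hb2def
  set b3 := bump b2 6 with hb3def
  have e10 : b1 0 = b 0 := bump_zero b 6
  have e20 : b2 0 = b 0 := (bump_zero b1 6).trans e10
  have e30 : b3 0 = b 0 := (bump_zero b2 6).trans e20
  have e17 : b1 7 = b 7 + 1 := bump6_seven b
  have e27 : b2 7 = b 7 + 2 := by rw [hb2def, bump6_seven, e17]; ring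
  have hd1 : dOf b1 = dOf b - 1 := dOf_bump b hi7
  have hd2 : dOf b2 = dOf b - 2 := by rw [hb2def, dOf_bump b1 hi7, hd1]; ring
  have hd3 : dOf b3 = dOf b - 3 := by rw [hb3def, dOf_bump b2 hi7, hd2]; ring
  have hB1 : InBox b1 := inBox_bump6 b hb (by omega)
  have hB2 : InBox b2 := inBox_bump6 b1 hB1 (by rw [e17, e10]; omega)
  have hB3 : InBox b3 := inBox_bump6 b2 hB2 (by rw [e27, e20]; omega)
  have hN : 1 ≤ (b 0).toNat := by have h70 : 0 ≤ b 7 := (hb.2 6 hi7).1; omega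
  have key := coeffV_rel_of_summable4 b b1 b2 b3 (b 0).toNat hN hb hB1 hB2 hB3
    (by rw [sum_slots_eq]; omega) (by rw [sum_slots_eq, hd1]; omega)
    (by rw [sum_slots_eq, hd2]; omega) (by rw [sum_slots_eq, hd3]; omega)
    rfl (by rw [e10]) (by rw [e20]) (by rw [e30])
    (topGamma0 b) (topGamma1 b) (topGamma2 b) (topGamma3 b)
    (topTelescoper b) (natDegree_topTelescoper_succ_le b hb hd)
    (by rw [← top_fourTerm b hb]; ring)
  have h1 : (topTelescoper b).eval 1 = 0 := by simp [topTelescoper]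
  rw [h1, zero_div] at key
  linear_combination key

/-- **`U`, `W`, `V` are three solutions of one four-term relation along slot 7** (packaging of
`fourTerm_coeff_rel` and `fourTerm_coeffV_rel`). -/
theorem fourTerm_coeff_rel_UWV (b : ℕ → ℤ) (hb : InBox b) (hd : 2 ≤ dOf b) (h7 : b 7 + 2 ≤ b 0) :
    (topGamma3 b * coeffU (bump (bump (bump b 6) 6) 6) + topGamma2 b * coeffU (bump (bump b 6) 6) +
        topGamma1 b * coeffU (bump b 6) + topGamma0 b * coeffU b = 0) ∧
      (topGamma3 b * coeffW (bump (bump (bump b 6) 6) 6) + topGamma2 b * coeffW (bump (bump b 6) 6) +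
        topGamma1 b * coeffW (bump b 6) + topGamma0 b * coeffW b = 0) ∧
      (topGamma3 b * coeffV (bump (bump (bump b 6) 6) 6) + topGamma2 b * coeffV (bump (bump b 6) 6) +
        topGamma1 b * coeffV (bump b 6) + topGamma0 b * coeffV b = 0) :=
  ⟨(fourTerm_coeff_rel b hb hd h7).1, (fourTerm_coeff_rel b hb hd h7).2, fourTerm_coeffV_rel b hb hd h7⟩

/-! ### Mixed Casoratians: REC3 for the P-parts of the dictionary -/

/-- The slot-7 mixed Casoratian `U(b)V(b+e₇) − U(b+e₇)V(b)`; under the wedge dictionary's (conjectural, exactly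
verified) P̂-part this is `P̂(a)/ρ(a)` (memo §1: the P-parts are partner-free). -/
noncomputable def casUV (b : ℕ → ℤ) : ℚ := coeffU b * coeffV (bump b 6) - coeffU (bump b 6) * coeffV b

/-- The slot-7 mixed Casoratian `V(b)W(b+e₇) − V(b+e₇)W(b)`; under the dictionary's conjectural P-part this is
`P(a)/ρ(a)`. -/
noncomputable def casVW (b : ℕ → ℤ) : ℚ := coeffV b * coeffW (bump b 6) - coeffV (bump b 6) * coeffW b

/-- **Casoratian propagation, abstract form** (the algebra of `casoratian_pair_identities`): two solutions
`x`, `y` of one four-term relation. -/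
theorem cas_pair_of_fourTerm {γ0 γ1 γ2 γ3 x0 x1 x2 x3 y0 y1 y2 y3 : ℚ}
    (hx : γ3 * x3 + γ2 * x2 + γ1 * x1 + γ0 * x0 = 0) (hy : γ3 * y3 + γ2 * y2 + γ1 * y1 + γ0 * y0 = 0) :
    (γ3 * (x1 * y3 - x3 * y1) + γ2 * (x1 * y2 - x2 * y1) - γ0 * (x0 * y1 - x1 * y0) = 0) ∧
      (γ3 * (x2 * y3 - x3 * y2) = γ0 * (x0 * y2 - x2 * y0) + γ1 * (x1 * y2 - x2 * y1)) := by
  constructor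
  · linear_combination x1 * hy - y1 * hx
  · linear_combination (-y2) * hx + x2 * hy

/-- **REC3, abstract form** (the algebra of `quadM3_rec3`): the consecutive Casoratians `x_k y_{k+1} − x_{k+1} y_k`
of two solutions of the four-term relations at `a` (coefficients `γ`) and at `a + e₇` (coefficients `δ`). -/
theorem cas_rec3_of_fourTerm {γ0 γ1 γ2 γ3 δ0 δ1 δ2 δ3 x0 x1 x2 x3 x4 y0 y1 y2 y3 y4 : ℚ}
    (hx : γ3 * x3 + γ2 * x2 + γ1 * x1 + γ0 * x0 = 0) (hy : γ3 * y3 + γ2 * y2 + γ1 * y1 + γ0 * y0 = 0)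
    (hx' : δ3 * x4 + δ2 * x3 + δ1 * x2 + δ0 * x1 = 0) (hy' : δ3 * y4 + δ2 * y3 + δ1 * y2 + δ0 * y1 = 0) :
    δ3 * γ3 * (x3 * y4 - x4 * y3) =
      δ1 * γ3 * (x2 * y3 - x3 * y2) - δ0 * γ2 * (x1 * y2 - x2 * y1) + δ0 * γ0 * (x0 * y1 - x1 * y0) := by
  obtain ⟨hA, _⟩ := cas_pair_of_fourTerm hx hy
  obtain ⟨_, hB⟩ := cas_pair_of_fourTerm hx' hy'
  linear_combination γ3 * hB + δ0 * hA

/-- **REC3 for `U V′ − U′V`** (the `P̂/ρ` Casoratian): for `a` in the box with `d(a) ≥ 3`, `a₇ + 3 ≤ N`, and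
`a' = a + e₇`:
`γ₃(a')γ₃(a)·C(a+3e₇) = γ₁(a')γ₃(a)·C(a+2e₇) − γ₀(a')γ₂(a)·C(a+e₇) + γ₀(a')γ₀(a)·C(a)`, `C = casUV` — the SAME
recurrence as `quadM3_rec3`. -/
theorem casUV_rec3 (a : ℕ → ℤ) (ha : InBox a) (hd : 3 ≤ dOf a) (h7 : a 7 + 3 ≤ a 0) :
    topGamma3 (bump a 6) * topGamma3 a * casUV (bump (bump (bump a 6) 6) 6) =
      topGamma1 (bump a 6) * topGamma3 a * casUV (bump (bump a 6) 6) -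
        topGamma0 (bump a 6) * topGamma2 a * casUV (bump a 6) + topGamma0 (bump a 6) * topGamma0 a * casUV a := by
  have hi7 : (6 : ℕ) ∈ range 7 := mem_range.2 (by norm_num)
  have e10 : bump a 6 0 = a 0 := bump_zero a 6
  have e17 : bump a 6 7 = a 7 + 1 := bump6_seven a
  have hd1 : dOf (bump a 6) = dOf a - 1 := dOf_bump a hi7
  have hA1 : InBox (bump a 6) := inBox_bump6 a ha (by omega)
  obtain ⟨hU, -, hV⟩ := fourTerm_coeff_rel_UWV a ha (by omega) (by omega)
  obtain ⟨hU', -, hV'⟩ := fourTerm_coeff_rel_UWV (bump a 6) hA1 (by rw [hd1]; omega) (by rw [e17, e10]; omega)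
  unfold casUV
  exact cas_rec3_of_fourTerm hU hV hU' hV'

/-- **REC3 for `V W′ − V′W`** (the `P/ρ` Casoratian), same recurrence. -/
theorem casVW_rec3 (a : ℕ → ℤ) (ha : InBox a) (hd : 3 ≤ dOf a) (h7 : a 7 + 3 ≤ a 0) :
    topGamma3 (bump a 6) * topGamma3 a * casVW (bump (bump (bump a 6) 6) 6) =
      topGamma1 (bump a 6) * topGamma3 a * casVW (bump (bump a 6) 6) -
        topGamma0 (bump a 6) * topGamma2 a * casVW (bump a 6) + topGamma0 (bump a 6) * topGamma0 a * casVW a := by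
  have hi7 : (6 : ℕ) ∈ range 7 := mem_range.2 (by norm_num)
  have e10 : bump a 6 0 = a 0 := bump_zero a 6
  have e17 : bump a 6 7 = a 7 + 1 := bump6_seven a
  have hd1 : dOf (bump a 6) = dOf a - 1 := dOf_bump a hi7
  have hA1 : InBox (bump a 6) := inBox_bump6 a ha (by omega)
  obtain ⟨-, hW, hV⟩ := fourTerm_coeff_rel_UWV a ha (by omega) (by omega)
  obtain ⟨-, hW', hV'⟩ := fourTerm_coeff_rel_UWV (bump a 6) hA1 (by rw [hd1]; omega) (by rw [e17, e10]; omega)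
  unfold casVW
  exact cas_rec3_of_fourTerm hV hW hV' hW'

end Summit.KontsevichZagierPeriods.Zeta5Search.WedgeDictionary
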